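import Summits.CriticalPhenomena.PercolationContinuityZ3.Theorems.PercNearOneGluingNoHeavyLowerTailCoSunflowerGlue
import Summits.CriticalPhenomena.PercolationContinuityZ3.Theorems.PercNearOneGluingNoHeavyLowerTailE3FourPointClassesAllGraphs
import HarnessLib

/-!
# `NoHeavyLowerTail` (stmt-CriticalPhenomena-4575) — the open increasing E3GRP rows `r4, r5, r6` and the four-point classes
# `β, γ` follow from the two generators `TIncRow`, `GammaRow` (gluing = weight-one pairs)

Support file (prover prim-e3grp-switch-3; `--supports stmt-CriticalPhenomena-4575`).  No definitions, no named facts,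
no sorries.  Vocabulary of `…E3GroupSepLeFive` (`RowHolds i w (o,a₁,a₂,a₃,b)`, rows `4..8` increasing) and
`…E3FourPointClassesLeFive` (`Row4Holds i w (a,b,c,y)`, classes `4 = α`, `5 = β`, `6 = γ`).

* `preimage_insert_connEvent_lnk_left/right` — gluing a pair with one endpoint in a group enlarges that group:
  `{ω | insert s(c,y) ω ∈ U[X|Y]} = U[y∷X | Y]` for `c ∈ X` (and the `Y`-version);
* `rowHolds_four_of_gammaRow` (`r4 = γ` on `(o,a₁,a₂,a₃)`), `row4Holds_six_of_gammaRow` (class `γ`),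
  `row4Holds_five_of_tIncRow` (class `β` = `T_inc` with `{c,y}` glued),
  `rowHolds_six_of_gammaRow` (`r6 = γ(o,a₁,a₃,a₂)` with `{a₂,b}` glued),
  `rowHolds_five_of_tIncRow` (`r5 = T_inc(o,a₁,a₃)` with `{o,b}` and `{a₁,a₂}` glued).
So `TIncRow ∧ GammaRow` ⟹ every row of the sunflower class `{β, γ, r4, r5, r6}` for every `n`, every weight, every
terminal tuple; the second shape `{α, r7, r8}` is untouched.  All of these rows remain OPEN.
-/

noncomputable section

namespace Summit.CriticalPhenomena.PercolationContinuityZ3.Theorems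

open MeasureTheory Set
open Literature.Probability.LatticeModels
open Literature.Probability.Percolation
open CovTransferCert E3GroupSepCert CoSunflowerGlue

namespace CoSunflowerGlue

variable {n : ℕ}

/-! ### Gluing enlarges a group -/

/-- Gluing `{c,y}` with `c ∈ X`: `U[X|Y]` pulls back to `U[y∷X | Y]`. [folklore] -/
theorem preimage_insert_connEvent_lnk_left (X Y : List (Fin n)) {c : Fin n} (y : Fin n) (hc : c ∈ X) :
    {ω : BondConfig (Fin n) | insert s(c, y) ω ∈ connEvent (lnk X Y)} = connEvent (lnk (y :: X) Y) := by
  rw [connEvent_lnk, connEvent_lnk]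
  ext ω
  simp only [mem_setOf_eq, mem_openConn_insert_iff, List.mem_cons]
  constructor
  · rintro ⟨x, hx, z, hz, h | ⟨_, h2⟩ | ⟨_, h2⟩⟩
    · exact ⟨x, Or.inr hx, z, hz, h⟩
    · exact ⟨y, Or.inl rfl, z, hz, h2⟩
    · exact ⟨c, Or.inr hc, z, hz, h2⟩
  · rintro ⟨x, rfl | hx, z, hz, h⟩
    · exact ⟨c, hc, z, hz, Or.inr (Or.inl ⟨SimpleGraph.Reachable.refl _, h⟩)⟩
    · exact ⟨x, hx, z, hz, Or.inl h⟩

/-- Gluing `{c,y}` with `c ∈ Y`: `U[X|Y]` pulls back to `U[X | y∷Y]`. [folklore] -/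
theorem preimage_insert_connEvent_lnk_right (X Y : List (Fin n)) {c : Fin n} (y : Fin n) (hc : c ∈ Y) :
    {ω : BondConfig (Fin n) | insert s(c, y) ω ∈ connEvent (lnk X Y)} = connEvent (lnk X (y :: Y)) := by
  rw [connEvent_lnk, connEvent_lnk]
  ext ω
  simp only [mem_setOf_eq, mem_openConn_insert_iff, List.mem_cons]
  constructor
  · rintro ⟨x, hx, z, hz, h | ⟨h1, _⟩ | ⟨h1, _⟩⟩
    · exact ⟨x, hx, z, Or.inr hz, h⟩
    · exact ⟨x, hx, c, Or.inr hc, h1⟩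
    · exact ⟨x, hx, y, Or.inl rfl, h1⟩
  · rintro ⟨x, hx, z, rfl | hz, h⟩
    · exact ⟨x, hx, c, hc, Or.inr (Or.inr ⟨h, SimpleGraph.Reachable.refl _⟩)⟩
    · exact ⟨x, hx, z, hz, Or.inl h⟩

/-- Reordering a group does not change `U[X|Y]`. [folklore] -/
theorem connEvent_lnk_congr {X X' Y Y' : List (Fin n)} (hX : ∀ x, x ∈ X ↔ x ∈ X') (hY : ∀ y, y ∈ Y ↔ y ∈ Y') :
    connEvent (lnk X Y) = connEvent (lnk X' Y') := by
  rw [connEvent_lnk, connEvent_lnk]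
  ext ω
  simp only [mem_setOf_eq, hX, hY]

/-- `U[X|Y] = U[Y|X]`. [folklore] -/
theorem connEvent_lnk_swap (X Y : List (Fin n)) : connEvent (lnk X Y) = connEvent (lnk Y X) := by
  rw [connEvent_lnk, connEvent_lnk]
  ext ω
  simp only [mem_setOf_eq]
  constructor
  · rintro ⟨x, hx, z, hz, h⟩; exact ⟨z, hz, x, hx, SimpleGraph.Reachable.symm h⟩
  · rintro ⟨x, hx, z, hz, h⟩; exact ⟨z, hz, x, hx, SimpleGraph.Reachable.symm h⟩

/-- The `GammaRow` / `TIncRow` events in the `connEvent (lnk …)` vocabulary. [folklore] -/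
theorem setOf_lnk_eq_connEvent (X Y : List (Fin n)) :
    {ω : BondConfig (Fin n) | ∃ x ∈ {v | v ∈ X}, ∃ z ∈ {v | v ∈ Y}, (openGraph ω).Reachable x z} =
      connEvent (lnk X Y) := by
  rw [connEvent_lnk]; rfl

/-- `{a↔b} ∪ {a↔c} = U[a | bc]`. [folklore] -/
theorem union_openConn_eq_connEvent_lnk (a b c : Fin n) :
    (openConn a b ∪ openConn a c : Set (BondConfig (Fin n))) = connEvent (lnk [a] [b, c]) := by
  rw [connEvent_lnk]
  ext ω
  simp only [mem_union, mem_setOf_eq, List.mem_cons, List.not_mem_nil, or_false, exists_eq_left, exists_eq_or_imp]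

/-- `{a↔b} ∪ {b↔c} = U[b | ac]`. [folklore] -/
theorem union_openConn_eq_connEvent_lnk' (a b c : Fin n) :
    (openConn a b ∪ openConn b c : Set (BondConfig (Fin n))) = connEvent (lnk [b] [a, c]) := by
  rw [connEvent_lnk]
  ext ω
  simp only [mem_union, mem_setOf_eq, List.mem_cons, List.not_mem_nil, or_false, exists_eq_left, exists_eq_or_imp]
  rw [KNPreFKG.openConn_symm a b]

/-- `{a↔c} ∪ {b↔c} = U[c | ab]`. [folklore] -/
theorem union_openConn_eq_connEvent_lnk'' (a b c : Fin n) :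
    (openConn a c ∪ openConn b c : Set (BondConfig (Fin n))) = connEvent (lnk [c] [a, b]) := by
  rw [connEvent_lnk]
  ext ω
  simp only [mem_union, mem_setOf_eq, List.mem_cons, List.not_mem_nil, or_false, exists_eq_left, exists_eq_or_imp]
  rw [KNPreFKG.openConn_symm a c, KNPreFKG.openConn_symm b c]

/-- `GammaRow` in the `connEvent (lnk …)` vocabulary. [folklore] -/
theorem gammaRow_connEvent (h : GammaRow) (w : Sym2 (Fin n) → unitInterval) (a b c y : Fin n) :
    0 ≤ sahiE3 (prodBernoulli w) (connEvent (lnk [a, b] [c, y])) (connEvent (lnk [a, c] [b, y]))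
      (connEvent (lnk [a, y] [b, c])) := by
  have key := h (Fin n) w a b c y
  have e1 : {ω : BondConfig (Fin n) | ∃ x ∈ ({a, b} : Set (Fin n)), ∃ z ∈ ({c, y} : Set (Fin n)),
      (openGraph ω).Reachable x z} = connEvent (lnk [a, b] [c, y]) := by
    rw [connEvent_lnk]; ext ω; simp only [mem_setOf_eq, mem_insert_iff, mem_singleton_iff, List.mem_cons,
      List.not_mem_nil, or_false]; rfl
  have e2 : {ω : BondConfig (Fin n) | ∃ x ∈ ({a, c} : Set (Fin n)), ∃ z ∈ ({b, y} : Set (Fin n)),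
      (openGraph ω).Reachable x z} = connEvent (lnk [a, c] [b, y]) := by
    rw [connEvent_lnk]; ext ω; simp only [mem_setOf_eq, mem_insert_iff, mem_singleton_iff, List.mem_cons,
      List.not_mem_nil, or_false]; rfl
  have e3 : {ω : BondConfig (Fin n) | ∃ x ∈ ({a, y} : Set (Fin n)), ∃ z ∈ ({b, c} : Set (Fin n)),
      (openGraph ω).Reachable x z} = connEvent (lnk [a, y] [b, c]) := by
    rw [connEvent_lnk]; ext ω; simp only [mem_setOf_eq, mem_insert_iff, mem_singleton_iff, List.mem_cons,
      List.not_mem_nil, or_false]; rfl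
  rw [e1, e2, e3] at key
  exact key

/-- `TIncRow` in the `connEvent (lnk …)` vocabulary. [folklore] -/
theorem tIncRow_connEvent (h : TIncRow) (w : Sym2 (Fin n) → unitInterval) (a b c : Fin n) :
    0 ≤ sahiE3 (prodBernoulli w) (connEvent (lnk [a] [b, c])) (connEvent (lnk [b] [a, c]))
      (connEvent (lnk [c] [a, b])) := by
  have key := h (Fin n) w a b c
  rw [union_openConn_eq_connEvent_lnk, union_openConn_eq_connEvent_lnk', union_openConn_eq_connEvent_lnk''] at key
  exact key

/-! ### The four-point classes `γ` (row4 6) and `β` (row4 5) -/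

/-- **`GammaRow` ⇒ class `γ`** (`Row4Holds 6`) for every `n`, weight and terminals. [folklore] -/
theorem row4Holds_six_of_gammaRow (h : GammaRow) (w : Sym2 (Fin n) → unitInterval) (a b c y : Fin n) :
    Row4Holds 6 w (a, b, c, y) := by
  have hr : row4 6 (a, b, c, y) = (lnk [a, b] [c, y], lnk [a, c] [b, y], lnk [a, y] [b, c]) := rfl
  unfold Row4Holds
  rw [hr, e3Ineq_iff_sahiE3_nonneg]
  exact gammaRow_connEvent h w a b c y

/-- **`TIncRow` ⇒ class `β`** (`Row4Holds 5 = E₃(U[a|bcy], U[ab|cy], U[acy|b])`): `β` is `T_inc(a,b,c)` on the graph with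
`{c,y}` glued. [folklore] -/
theorem row4Holds_five_of_tIncRow (h : TIncRow) (w : Sym2 (Fin n) → unitInterval) (a b c y : Fin n) :
    Row4Holds 5 w (a, b, c, y) := by
  classical
  have hr : row4 5 (a, b, c, y) = (lnk [a] [b, c, y], lnk [a, b] [c, y], lnk [a, c, y] [b]) := rfl
  unfold Row4Holds
  rw [hr, e3Ineq_iff_sahiE3_nonneg]
  have key := tIncRow_connEvent h (Function.update w s(c, y) 1) a b c
  rw [sahiE3_update_one, preimage_insert_connEvent_lnk_right [a] [b, c] y (by simp),
    preimage_insert_connEvent_lnk_right [b] [a, c] y (by simp),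
    preimage_insert_connEvent_lnk_left [c] [a, b] y (by simp), sahiE3_comm₂₃] at key
  rw [connEvent_lnk_congr (X := [a]) (X' := [a]) (Y := [b, c, y]) (Y' := [y, b, c]) (fun _ => Iff.rfl)
      (fun v => by simp only [List.mem_cons, List.not_mem_nil, or_false]; tauto),
    connEvent_lnk_swap [a, b] [c, y],
    connEvent_lnk_congr (X := [c, y]) (X' := [y, c]) (Y := [a, b]) (Y' := [a, b])
      (fun v => by simp only [List.mem_cons, List.not_mem_nil, or_false]; tauto) (fun _ => Iff.rfl),
    connEvent_lnk_swap [a, c, y] [b],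
    connEvent_lnk_congr (X := [b]) (X' := [b]) (Y := [a, c, y]) (Y' := [y, a, c]) (fun _ => Iff.rfl)
      (fun v => by simp only [List.mem_cons, List.not_mem_nil, or_false]; tauto)]
  exact key

/-! ### The five-terminal rows `r4, r6` (from `γ`) and `r5` (from `T_inc`) -/

/-- **`GammaRow` ⇒ `r4`** (`RowHolds 4 = γ` on `(o,a₁,a₂,a₃)`). [folklore] -/
theorem rowHolds_four_of_gammaRow (h : GammaRow) (w : Sym2 (Fin n) → unitInterval) (t : Tup n) :
    RowHolds 4 w t := by
  obtain ⟨o, a₁, a₂, a₃, b⟩ := t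
  have hr : row 4 (o, a₁, a₂, a₃, b) = (lnk [o, a₁] [a₂, a₃], lnk [o, a₂] [a₁, a₃], lnk [o, a₃] [a₁, a₂]) := rfl
  unfold RowHolds
  rw [hr, e3Ineq_iff_sahiE3_nonneg]
  exact gammaRow_connEvent h w o a₁ a₂ a₃

/-- **`GammaRow` ⇒ `r6`** (`RowHolds 6 = E₃(U[oa₁|a₂a₃b], U[oa₃|a₁a₂b], U[oa₂b|a₁a₃])`): `r6` is `γ(o,a₁,a₃,a₂)` on the graph with
`{a₂,b}` glued. [folklore] -/
theorem rowHolds_six_of_gammaRow (h : GammaRow) (w : Sym2 (Fin n) → unitInterval) (t : Tup n) :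
    RowHolds 6 w t := by
  classical
  obtain ⟨o, a₁, a₂, a₃, b⟩ := t
  have hr : row 6 (o, a₁, a₂, a₃, b) =
      (lnk [o, a₁] [a₂, a₃, b], lnk [o, a₃] [a₁, a₂, b], lnk [o, a₂, b] [a₁, a₃]) := rfl
  unfold RowHolds
  rw [hr, e3Ineq_iff_sahiE3_nonneg]
  have key := gammaRow_connEvent h (Function.update w s(a₂, b) 1) o a₁ a₃ a₂
  rw [sahiE3_update_one, preimage_insert_connEvent_lnk_right [o, a₁] [a₃, a₂] b (by simp),
    preimage_insert_connEvent_lnk_right [o, a₃] [a₁, a₂] b (by simp),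
    preimage_insert_connEvent_lnk_left [o, a₂] [a₁, a₃] b (by simp)] at key
  rw [connEvent_lnk_congr (X := [o, a₁]) (X' := [o, a₁]) (Y := [a₂, a₃, b]) (Y' := [b, a₃, a₂]) (fun _ => Iff.rfl)
      (fun v => by simp only [List.mem_cons, List.not_mem_nil, or_false]; tauto),
    connEvent_lnk_congr (X := [o, a₃]) (X' := [o, a₃]) (Y := [a₁, a₂, b]) (Y' := [b, a₁, a₂]) (fun _ => Iff.rfl)
      (fun v => by simp only [List.mem_cons, List.not_mem_nil, or_false]; tauto),
    connEvent_lnk_congr (X := [o, a₂, b]) (X' := [b, o, a₂]) (Y := [a₁, a₃]) (Y' := [a₁, a₃])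
      (fun v => by simp only [List.mem_cons, List.not_mem_nil, or_false]; tauto) (fun _ => Iff.rfl)]
  exact key

/-- **`TIncRow` ⇒ `r5`** (`RowHolds 5 = E₃(U[ob|a₁a₂a₃], U[oa₁a₂b|a₃], U[oa₃b|a₁a₂])`): `r5` is `T_inc(o,a₃,a₁)` on the graph
with `{o,b}` and `{a₁,a₂}` glued. [folklore] -/
theorem rowHolds_five_of_tIncRow (h : TIncRow) (w : Sym2 (Fin n) → unitInterval) (t : Tup n) :
    RowHolds 5 w t := by
  classical
  obtain ⟨o, a₁, a₂, a₃, b⟩ := t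
  have hr : row 5 (o, a₁, a₂, a₃, b) =
      (lnk [o, b] [a₁, a₂, a₃], lnk [o, a₁, a₂, b] [a₃], lnk [o, a₃, b] [a₁, a₂]) := rfl
  unfold RowHolds
  rw [hr, e3Ineq_iff_sahiE3_nonneg]
  -- T_inc(o, a₃, a₁) on `w` with `{a₁,a₂}` glued, then `{o,b}` glued
  have key := tIncRow_connEvent h (Function.update (Function.update w s(o, b) 1) s(a₁, a₂) 1) o a₃ a₁
  rw [sahiE3_update_one, preimage_insert_connEvent_lnk_right [o] [a₃, a₁] a₂ (by simp),
    preimage_insert_connEvent_lnk_right [a₃] [o, a₁] a₂ (by simp),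
    preimage_insert_connEvent_lnk_left [a₁] [o, a₃] a₂ (by simp)] at key
  rw [sahiE3_update_one, preimage_insert_connEvent_lnk_left [o] [a₂, a₃, a₁] b (by simp),
    preimage_insert_connEvent_lnk_right [a₃] [a₂, o, a₁] b (by simp),
    preimage_insert_connEvent_lnk_right [a₂, a₁] [o, a₃] b (by simp)] at key
  rw [connEvent_lnk_congr (X := [o, b]) (X' := [b, o]) (Y := [a₁, a₂, a₃]) (Y' := [a₂, a₃, a₁])
      (fun v => by simp only [List.mem_cons, List.not_mem_nil, or_false]; tauto)
      (fun v => by simp only [List.mem_cons, List.not_mem_nil, or_false]; tauto),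
    connEvent_lnk_swap [o, a₁, a₂, b] [a₃],
    connEvent_lnk_congr (X := [a₃]) (X' := [a₃]) (Y := [o, a₁, a₂, b]) (Y' := [b, a₂, o, a₁]) (fun _ => Iff.rfl)
      (fun v => by simp only [List.mem_cons, List.not_mem_nil, or_false]; tauto),
    connEvent_lnk_swap [o, a₃, b] [a₁, a₂],
    connEvent_lnk_congr (X := [a₁, a₂]) (X' := [a₂, a₁]) (Y := [o, a₃, b]) (Y' := [b, o, a₃])
      (fun v => by simp only [List.mem_cons, List.not_mem_nil, or_false]; tauto)
      (fun v => by simp only [List.mem_cons, List.not_mem_nil, or_false]; tauto)]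
  exact key

end CoSunflowerGlue

end Summit.CriticalPhenomena.PercolationContinuityZ3.Theorems

end
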